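import Mathlib.RingTheory.Smooth.StandardSmooth
import Mathlib.RingTheory.Smooth.StandardSmoothCotangent
import Mathlib.RingTheory.Extension.Presentation.Submersive
import Mathlib.RingTheory.FinitePresentation
import Mathlib.RingTheory.TensorProduct.Basic
import Mathlib.RingTheory.Flat.EquationalCriterion
import Mathlib.RingTheory.Ideal.Quotient.Operations
import Mathlib.RingTheory.Ideal.Over
import Mathlib.RingTheory.TensorProduct.Quotient
import Mathlib.RingTheory.Flat.Stability
import Mathlib.LinearAlgebra.Finsupp.LinearCombination
import Mathlib.RingTheory.Polynomial.Basic
import Mathlib.RingTheory.Nilpotent.Basic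
import Mathlib.RingTheory.Nilpotent.Lemmas
import Mathlib.RingTheory.Ideal.Quotient.Nilpotent
import HarnessLib

/-!
# The lifting problem (Stacks, Smoothing Ring Maps, §07CJ: Lemmas 07CK, 07CL, Prop. 07CM)

Topic: `Literature/AlgebraicGeometry/Resolution`. Support file of the INLINE proof of the named
fact `Stacks07FE_resolveSpecial` (`NeronPopescuSteps.lean`), companion of
`NeronPopescuOgoma.lean` (07FC, 07FD) and `NeronPopescuFlatSeparable.lean` (07DY, 07BV). The
last paragraph of the printed proof of 07FE invokes **Proposition 07CM**: "Let `R → Λ` be a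
ring map. Let `I ⊂ R` be an ideal. Assume that (1) `I` is nilpotent, (2) `Λ/IΛ` is a filtered
colimit of smooth `R/I`-algebras, and (3) `R → Λ` is flat. Then `Λ` is a filtered colimit of
smooth `R`-algebras." This file PROVES it (sorry-free, no named facts), together with the two
lemmas of Stacks §07CJ it rests on, in the factorisation form of Algebra, Lemma 07C3 (every
finitely presented `A → Λ` factors through a smooth algebra) — with STANDARD smooth algebras
(`Algebra.IsStandardSmooth`) both in the hypothesis and in the conclusion, which is what the
induction on the order of nilpotency feeds back into itself (Stacks passes between "smooth" and
"standard smooth" colimits by Lemma 07CI; the standard smooth conclusion is the stronger one,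
and in the application to 07FE the hypothesis is supplied in standard smooth form by Mathlib's
`Algebra.IsSmoothAt.exists_notMem_isStandardSmooth`).

* `HasStandardSmoothFactorizations R Λ` — the property "every `R`-algebra map `A → Λ` with `A`
  finitely presented factors through a standard smooth `R`-algebra" (07C3 (2) / 07CI).
* `exists_isStandardSmooth_lift_of_surjective` — the device of the proof of 07CK: a standard
  smooth algebra over `R₀ = R₁/K`, `K` nilpotent, lifts to a standard smooth `R₁`-algebra `B`
  with a surjection `B → S₀` of kernel `KB` (lift the relations of a submersive presentation;
  the Jacobian stays a unit because `KB` is nilpotent — Stacks adds a variable `x_{n+1}` with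
  `x_{n+1} det = 1` instead). Also `isStandardSmooth_mvPolynomial` (no relations).
* `Stacks07CK_exists_factorization` — **Lemma 07CK**, for a nilpotent (not only square-zero)
  kernel: `A → B/J → Λ₁` with `B` standard smooth and `J ⊆ KB` finitely generated. The proof
  is a streamlined version of the printed one which avoids identifying `A'/IA'` with `B̄[δ]`:
  present `A = P/𝔞`; lift `P → A/KA → C₀` to `P → B₁` (`B₁` a lift of the standard smooth `C₀`)
  and `B₁ → C₀ → Λ₀` to `β : B₁ → Λ₁` (formal smoothness); the two maps `P → Λ₁` differ by
  `Σ ε_{ji} μ_{ji}`, `ε_{ji} ∈ K`, absorbed by `B = B₁[δ_{ji}]`, `z_j ↦ χ(z_j) + Σ ε_{ji} δ_{ji}`,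
  `δ_{ji} ↦ μ_{ji}`; `J = 𝔞B ⊆ KB` because modulo `K` the map `P → B` is `P → A/KA → C₀ ⊆ C₀[δ]`.
* `Stacks07CL_single`, `Stacks07CL_exists_factorization` — **Lemma 07CL** (square-zero `K`,
  `Λ₁` flat): kill finitely many elements of `KB` in the kernel of `B → Λ₁` after passing to a
  further standard smooth `B'`; the printed proof verbatim (equational criterion of flatness,
  Mathlib's `Module.Flat.isTrivialRelation_of_sum_smul_eq_zero`; `C = B[x]/(b_i - Σ a_{ij}x_j)`;
  07CK; formal smoothness of `B`; `α(h) = Σ ε_i a_{ij} ξ_j + Σ ε_i θ_i = 0`).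
* `hasStandardSmoothFactorizations_of_sq_zero` — **07CM for `K² = 0`** (07CK + 07CL).
* `hasStandardSmoothFactorizations_quotient_of_pow_le`, `Stacks07CM_hasStandardSmoothFactorizations`,
  `Stacks07CM_exists_smooth_factorization` — **Proposition 07CM**: induction on the order of
  nilpotency (`J₀ = J + I^{m+1}` over `J ⊇ I^{m+2}`, then `R → R/0`).

## Rendering notes

* "Two-ring form": to run the induction without iterated quotient types, the square-zero
  statements are made for an `R₁`-algebra `R₀` with surjective structure map of kernel `K`
  (`K² = 0`, resp. `K` nilpotent), an `R₀`-algebra `Λ₀` which is also an `R₁`-algebra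
  (scalar tower) and a surjection `p : Λ₁ → Λ₀` over `R₁` with kernel `KΛ₁`; the instances for
  `R/J → R/J₀`, `Λ/JΛ → Λ/J₀Λ` are Mathlib's `Ideal.Quotient.algebraQuotientMapQuotient` and
  `Ideal.Quotient.algebraQuotientOfLEComap`.
* Universes: sources `A` and the smooth algebras live in the universe of the base ring, the
  algebra `Λ` is arbitrary (as in `HasSmoothFactorizations` of `NeronPopescuSingularIdeal.lean`,
  which is the `FiniteType`/`Smooth` variant of the same property).

## Sources

* The Stacks Project, *Smoothing Ring Maps* (Tag 07BW), Section 07CJ "The lifting problem":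
  Lemma 07CK, Lemma 07CL, Proposition 07CM, with their proofs; Lemma 07CI; *Algebra*: Lemma
  07C3 (10.127.4), Lemma 00HK (equational criterion of flatness), Prop. 00TN (smooth ⇒ formally
  smooth), Lemma 00R2. [StacksProject]
-/

noncomputable section

namespace Literature.AlgebraicGeometry.Resolution

universe u v

open MvPolynomial TensorProduct

/-! ## Lifting standard smooth algebras along a nilpotent thickening -/

section LiftStandardSmooth

/-- Units lift along a surjective ring map with nilpotent kernel. [folklore] -/
theorem isUnit_of_isUnit_map_of_ker_le_nilradical {B S : Type*} [CommRing B] [CommRing S]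
    (θ : B →+* S) (hθ : Function.Surjective θ) (hker : ∀ z ∈ RingHom.ker θ, IsNilpotent z)
    {x : B} (hx : IsUnit (θ x)) : IsUnit x := by
  obtain ⟨y, hy⟩ := hθ ((hx.unit⁻¹ : Sˣ) : S)
  have h1 : x * y - 1 ∈ RingHom.ker θ := by
    rw [RingHom.mem_ker, map_sub, map_mul, hy, map_one, IsUnit.mul_val_inv, sub_self]
  have h2 : IsUnit (x * y) := by
    have := IsNilpotent.isUnit_one_add (hker _ h1)
    rwa [add_sub_cancel] at this
  exact isUnit_of_mul_isUnit_left h2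

/-- An ideal generated by the image of a nilpotent ideal is nilpotent. [folklore] -/
theorem Ideal.isNilpotent_map_of_isNilpotent {R B : Type*} [CommRing R] [CommRing B]
    (f : R →+* B) {K : Ideal R} (hK : IsNilpotent K) : IsNilpotent (K.map f) := by
  obtain ⟨n, hn⟩ := hK
  refine ⟨n, ?_⟩
  rw [← Ideal.map_pow, hn, Ideal.zero_eq_bot, Ideal.map_bot]
  exact Ideal.zero_eq_bot.symm

/-- **Standard smooth algebras lift along surjections with nilpotent kernel** (the device of
Stacks, Lemma 07CK: "Choose a presentation `A'/IA' = R/I[x_1, …, x_n]/(f̄_1, …, f̄_c)` with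
`det(∂f̄_j/∂x_i)_{i,j=1,…,c}` invertible in `A'/IA'`. Choose lifts `f_1, …, f_c ∈ R[x_1, …, x_n]`.
Then `B = R[x_1, …, x_n, x_{n+1}]/(f_1, …, f_c, x_{n+1} det(∂f_j/∂x_i) - 1)` is smooth over
`R`"; when the kernel is nilpotent the extra variable `x_{n+1}` is unnecessary, the determinant
being already a unit in `R[x]/(f)`). For a surjection `q : R₁ → R₀` with nilpotent kernel `K` and
a standard smooth `R₀`-algebra `S₀` there is a standard smooth `R₁`-algebra `B` with a
surjection `θ : B → S₀` over `q` whose kernel is `KB`. [cite: StacksProject, Tag 07CK (proof)] -/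
theorem exists_isStandardSmooth_lift_of_surjective {R₁ R₀ : Type u} [CommRing R₁] [CommRing R₀]
    (q : R₁ →+* R₀) (hq : Function.Surjective q) (hK : IsNilpotent (RingHom.ker q))
    (S₀ : Type v) [CommRing S₀] [Algebra R₀ S₀] [Algebra.IsStandardSmooth R₀ S₀] :
    ∃ (B : Type u) (_ : CommRing B) (_ : Algebra R₁ B), Algebra.IsStandardSmooth R₁ B ∧
      ∃ θ : B →+* S₀, θ.comp (algebraMap R₁ B) = (algebraMap R₀ S₀).comp q ∧
        Function.Surjective θ ∧ RingHom.ker θ = (RingHom.ker q).map (algebraMap R₁ B) := by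
  classical
  obtain ⟨ι, σ, _, _, ⟨P⟩⟩ := ‹Algebra.IsStandardSmooth R₀ S₀›.out
  haveI : Fintype ι := Fintype.ofFinite ι
  haveI : Fintype σ := Fintype.ofFinite σ
  set K := RingHom.ker q with hK_def
  -- lift the relations of `P` along `q`
  have hmap : Function.Surjective (MvPolynomial.map (σ := ι) q) := MvPolynomial.map_surjective q hq
  choose f hf using fun j => hmap (P.relation j)
  set 𝔟 : Ideal (MvPolynomial ι R₁) := Ideal.span (Set.range f) with h𝔟_def
  -- evaluation `R₁[x] → R₀[x] → S₀`
  let ev : MvPolynomial ι R₁ →+* S₀ :=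
    (MvPolynomial.aeval P.val).toRingHom.comp (MvPolynomial.map q)
  have hev : ∀ p, ev p = MvPolynomial.aeval P.val (MvPolynomial.map q p) := fun p => rfl
  have hevf : ∀ j, ev (f j) = 0 := fun j => by rw [hev, hf, P.aeval_val_relation]
  have h𝔟ev : ∀ a ∈ 𝔟, ev a = 0 := by
    intro a ha
    rw [← RingHom.mem_ker]
    refine (Ideal.span_le.mpr ?_) ha
    rintro _ ⟨j, rfl⟩
    exact hevf j
  let θ : MvPolynomial ι R₁ ⧸ 𝔟 →+* S₀ := Ideal.Quotient.lift 𝔟 ev h𝔟ev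
  have hθmk : ∀ p, θ (Ideal.Quotient.mk 𝔟 p) = ev p := fun p => rfl
  -- compatibility with `q`
  have halgR : (Ideal.Quotient.mk 𝔟).comp MvPolynomial.C =
      algebraMap R₁ (MvPolynomial ι R₁ ⧸ 𝔟) := by
    ext r
    rw [RingHom.comp_apply, IsScalarTower.algebraMap_apply R₁ (MvPolynomial ι R₁)
      (MvPolynomial ι R₁ ⧸ 𝔟), Ideal.Quotient.algebraMap_eq, MvPolynomial.algebraMap_eq]
  have hcomp : θ.comp (algebraMap R₁ (MvPolynomial ι R₁ ⧸ 𝔟)) = (algebraMap R₀ S₀).comp q := by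
    ext r
    simp only [RingHom.coe_comp, Function.comp_apply]
    rw [← halgR, RingHom.comp_apply, hθmk, hev, MvPolynomial.map_C, MvPolynomial.aeval_C]
  -- surjectivity
  have hsurj : Function.Surjective θ := by
    intro s
    obtain ⟨p₀, hp₀⟩ := P.algebraMap_surjective s
    obtain ⟨p, rfl⟩ := hmap p₀
    refine ⟨Ideal.Quotient.mk 𝔟 p, ?_⟩
    rw [hθmk, hev, ← hp₀, P.algebraMap_apply]
  -- kernel
  have hrel : (⇑(MvPolynomial.map q) ∘ f) = P.relation := funext fun j => hf j
  have hspan : Ideal.span (Set.range P.relation) = 𝔟.map (MvPolynomial.map q) := by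
    rw [h𝔟_def, Ideal.map_span, ← Set.range_comp, hrel]
  have hker : RingHom.ker θ = K.map (algebraMap R₁ (MvPolynomial ι R₁ ⧸ 𝔟)) := by
    apply le_antisymm
    · intro b hb
      obtain ⟨p, rfl⟩ := Ideal.Quotient.mk_surjective b
      rw [RingHom.mem_ker, hθmk, hev, ← RingHom.mem_ker, ← P.ker_eq_ker_aeval_val,
        ← P.span_range_relation_eq_ker, hspan,
        Ideal.mem_map_iff_of_surjective _ hmap] at hb
      obtain ⟨x, hx, hxp⟩ := hb
      have hpx : p - x ∈ K.map (MvPolynomial.C : R₁ →+* MvPolynomial ι R₁) := by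
        rw [hK_def, ← MvPolynomial.ker_map q, RingHom.mem_ker, map_sub, hxp, sub_self]
      have hp : p = x + (p - x) := by ring
      rw [hp, map_add, Ideal.Quotient.eq_zero_iff_mem.mpr hx, zero_add, ← halgR, ← Ideal.map_map]
      exact Ideal.mem_map_of_mem _ hpx
    · rw [Ideal.map_le_iff_le_comap]
      intro r hr
      rw [Ideal.mem_comap, RingHom.mem_ker, ← RingHom.comp_apply, hcomp, RingHom.comp_apply,
        RingHom.mem_ker.mp hr, map_zero]
  -- the naive presentation of `B = R₁[x]/(f)` is submersive: its Jacobian maps to that of `P`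
  let P₁ : Algebra.PreSubmersivePresentation R₁ (MvPolynomial ι R₁ ⧸ 𝔟) ι σ :=
    Algebra.PreSubmersivePresentation.naive (v := f) P.map P.map_inj
  have halg : algebraMap P₁.Ring (MvPolynomial ι R₁ ⧸ 𝔟) = Ideal.Quotient.mk 𝔟 := rfl
  have hM : (MvPolynomial.map q).mapMatrix P₁.jacobiMatrix = P.jacobiMatrix :=
    Matrix.ext fun i j => by
      rw [RingHom.mapMatrix_apply, Matrix.map_apply,
        Algebra.PreSubmersivePresentation.jacobiMatrix_naive,
        Algebra.PreSubmersivePresentation.jacobiMatrix_apply, ← MvPolynomial.pderiv_map, hf]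
  have hjac : θ P₁.jacobian = P.jacobian := by
    rw [P₁.jacobian_eq_jacobiMatrix_det, P.jacobian_eq_jacobiMatrix_det, halg, hθmk, hev,
      RingHom.map_det, hM, P.algebraMap_apply]
  have hunit : IsUnit P₁.jacobian := by
    refine isUnit_of_isUnit_map_of_ker_le_nilradical θ hsurj (fun z hz => ?_) ?_
    · rw [hker] at hz
      obtain ⟨n, hn⟩ := Ideal.isNilpotent_map_of_isNilpotent
        (algebraMap R₁ (MvPolynomial ι R₁ ⧸ 𝔟)) hK
      exact ⟨n, by
        have := Ideal.pow_mem_pow hz n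
        rw [hn, Ideal.zero_eq_bot, Ideal.mem_bot] at this
        exact this⟩
    · rw [hjac]
      exact P.jacobian_isUnit
  let P₁' : Algebra.SubmersivePresentation R₁ (MvPolynomial ι R₁ ⧸ 𝔟) ι σ :=
    { toPreSubmersivePresentation := P₁, jacobian_isUnit := hunit }
  exact ⟨MvPolynomial ι R₁ ⧸ 𝔟, inferInstance, inferInstance, P₁'.isStandardSmooth, θ, hcomp,
    hsurj, hker⟩

end LiftStandardSmooth

/-! ## Polynomial algebras are standard smooth -/

section MvPolynomialStandardSmooth

/-- A polynomial algebra in finitely many variables is standard smooth (the presentation with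
no relations). [folklore] -/
theorem isStandardSmooth_mvPolynomial (R : Type u) [CommRing R] (ι : Type) [Finite ι] :
    Algebra.IsStandardSmooth R (MvPolynomial ι R) := by
  classical
  let P : Algebra.Presentation R (MvPolynomial ι R) ι PEmpty.{1} :=
    { toGenerators := Algebra.Generators.mvPolynomial R ι
      relation := PEmpty.elim
      span_range_relation_eq_ker := by
        rw [Algebra.Generators.ker_mvPolynomial, Set.range_eq_empty, Ideal.span_empty] }
  let P' : Algebra.PreSubmersivePresentation R (MvPolynomial ι R) ι PEmpty.{1} :=
    { toPresentation := P
      map := PEmpty.elim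
      map_inj := fun a => a.elim }
  have hunit : IsUnit P'.jacobian := by
    rw [P'.jacobian_eq_jacobiMatrix_det, Matrix.det_isEmpty, map_one]
    exact isUnit_one
  let P'' : Algebra.SubmersivePresentation R (MvPolynomial ι R) ι PEmpty.{1} :=
    { toPreSubmersivePresentation := P', jacobian_isUnit := hunit }
  exact P''.isStandardSmooth

/-- Polynomial algebras over standard smooth algebras are standard smooth. [folklore] -/
theorem isStandardSmooth_mvPolynomial_of_isStandardSmooth (R : Type u) [CommRing R]
    (B : Type v) [CommRing B] [Algebra R B] [Algebra.IsStandardSmooth R B] (ι : Type) [Finite ι] :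
    Algebra.IsStandardSmooth R (MvPolynomial ι B) :=
  haveI := isStandardSmooth_mvPolynomial B ι
  Algebra.IsStandardSmooth.trans R B (MvPolynomial ι B)

end MvPolynomialStandardSmooth

/-! ## Standard smooth factorisations (Stacks 07C3 / 07CI form of "ind-(standard) smooth") -/

section Factorizations

/-- **"`Λ` is a filtered colimit of standard smooth `R`-algebras"** in the factorisation form of
Stacks, Algebra, Lemma 07C3 (and Smoothing Ring Maps, Lemma 07CI): every `R`-algebra map
`A → Λ` with `A` of finite presentation factors through a standard smooth `R`-algebra. This is
the form in which the property is produced and consumed in Stacks, Section 07CJ (the lifting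
problem). [cite: StacksProject, Tag 07CI] -/
def HasStandardSmoothFactorizations (R : Type u) (Λ : Type v) [CommRing R] [CommRing Λ]
    [Algebra R Λ] : Prop :=
  ∀ (A : Type u) [CommRing A] [Algebra R A], Algebra.FinitePresentation R A →
    ∀ φ : A →ₐ[R] Λ, ∃ (C : Type u) (_ : CommRing C) (_ : Algebra R C),
      Algebra.IsStandardSmooth R C ∧ ∃ (α : A →ₐ[R] C) (β : C →ₐ[R] Λ), β.comp α = φ

end Factorizations

/-! ## Stacks 07CK -/

section Stacks07CK

variable {R₁ R₀ : Type u} [CommRing R₁] [CommRing R₀] [Algebra R₁ R₀]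
  {Λ₁ : Type v} [CommRing Λ₁] [Algebra R₁ Λ₁]
  {Λ₀ : Type v} [CommRing Λ₀] [Algebra R₁ Λ₀] [Algebra R₀ Λ₀] [IsScalarTower R₁ R₀ Λ₀]

/-- **Stacks, Lemma 07CK** (two-ring form: `R₀ = R₁/K` is any quotient with nilpotent kernel
`K`, `Λ₀ = Λ₁/KΛ₁`). "Let `R → Λ` be a ring map. Let `I ⊂ R` be an ideal. Assume that (1)
`I² = 0` [here: `I` nilpotent], and (2) `Λ/IΛ` is a filtered colimit of [standard] smooth
`R/I`-algebras. Let `φ : A → Λ` be an `R`-algebra map with `A` of finite presentation over `R`.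
Then there exists a factorization `A → B/J → Λ` where `B` is a [standard] smooth `R`-algebra
and `J ⊂ IB` is a finitely generated ideal." Proof (a streamlined form of the printed one):
present `A = P/𝔞`, `P = R[z]`; over `R/I` factor `A/IA → C₀ → Λ/IΛ` with `C₀` standard smooth;
lift `C₀` to a standard smooth `B₁` over `R` (`exists_isStandardSmooth_lift_of_surjective`),
lift `P → A/IA → C₀` to `χ : P → B₁` (`P` is a polynomial ring) and `B₁ → C₀ → Λ/IΛ` to
`β : B₁ → Λ` (formal smoothness, `IΛ` nilpotent); the two maps `P → Λ` agree modulo `IΛ`, say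
`φ(z_j) - β(χ(z_j)) = Σ ε_{ji} μ_{ji}` with `ε_{ji} ∈ I`; put `B = B₁[δ_{ji}]`,
`χ'(z_j) = χ(z_j) + Σ ε_{ji} δ_{ji}`, `β'(δ_{ji}) = μ_{ji}`, so that `β' ∘ χ' = φ` on `P`, and
`J = χ'(𝔞)B ⊆ IB` (modulo `I`, `χ'` is `P → A/IA → C₀ ⊆ C₀[δ]`, which kills `𝔞`).
[cite: StacksProject, Tag 07CK] -/
theorem Stacks07CK_exists_factorization (hq : Function.Surjective (algebraMap R₁ R₀))
    (hK : IsNilpotent (RingHom.ker (algebraMap R₁ R₀)))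
    (p : Λ₁ →ₐ[R₁] Λ₀) (hp : Function.Surjective p)
    (hkerp : RingHom.ker p = (RingHom.ker (algebraMap R₁ R₀)).map (algebraMap R₁ Λ₁))
    (h₀ : HasStandardSmoothFactorizations R₀ Λ₀)
    (A : Type u) [CommRing A] [Algebra R₁ A] [Algebra.FinitePresentation R₁ A]
    (φ : A →ₐ[R₁] Λ₁) :
    ∃ (B : Type u) (_ : CommRing B) (_ : Algebra R₁ B), Algebra.IsStandardSmooth R₁ B ∧
      ∃ J : Ideal B, J.FG ∧ J ≤ (RingHom.ker (algebraMap R₁ R₀)).map (algebraMap R₁ B) ∧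
        ∃ (α : A →ₐ[R₁] B ⧸ J) (β : B ⧸ J →ₐ[R₁] Λ₁), β.comp α = φ := by
  classical
  set K := RingHom.ker (algebraMap R₁ R₀) with hKdef
  have hKq : ∀ r ∈ K, algebraMap R₁ R₀ r = 0 := fun r hr => hr
  -- a presentation `P = R₁[z] → A`
  obtain ⟨m, pr, hpr, hker_fg⟩ := Algebra.FinitePresentation.out (R := R₁) (A := A)
  -- base change to `R₀`
  let A₀ := R₀ ⊗[R₁] A
  let u : A →ₐ[R₁] A₀ := Algebra.TensorProduct.includeRight
  let φ₀ : A₀ →ₐ[R₀] Λ₀ :=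
    Algebra.TensorProduct.lift (Algebra.ofId R₀ Λ₀) (p.comp φ) fun _ _ => Commute.all _ _
  have hφ₀ : ∀ a, φ₀ (u a) = p (φ a) := fun a => by
    change φ₀ ((1 : R₀) ⊗ₜ[R₁] a) = _
    rw [Algebra.TensorProduct.lift_tmul, map_one, one_mul, AlgHom.comp_apply]
  obtain ⟨C₀, _, _, hC₀, α₀, β₀, hαβ₀⟩ := h₀ A₀ inferInstance φ₀
  have hαβ₀' : ∀ y, β₀ (α₀ y) = φ₀ y := fun y => AlgHom.congr_fun hαβ₀ y
  -- lift `C₀` to a standard smooth `R₁`-algebra `B₁`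
  obtain ⟨B₁, _, _, hB₁, θ₁, hθ₁c, hθ₁s, hθ₁k⟩ :=
    exists_isStandardSmooth_lift_of_surjective (algebraMap R₁ R₀) hq hK C₀
  haveI := hB₁
  have hθ₁r : ∀ r, θ₁ (algebraMap R₁ B₁ r) = algebraMap R₀ C₀ (algebraMap R₁ R₀ r) := fun r =>
    RingHom.congr_fun hθ₁c r
  have hα₀r : ∀ r, α₀ (u (algebraMap R₁ A r)) = algebraMap R₀ C₀ (algebraMap R₁ R₀ r) := by
    intro r
    rw [u.commutes, IsScalarTower.algebraMap_apply R₁ R₀ A₀, α₀.commutes]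
  -- `χ : P → B₁` lifting `P → A → A₀ → C₀` (only its values on the variables are needed)
  have hb : ∀ j : Fin m, ∃ b : B₁, θ₁ b = α₀ (u (pr (X j))) := fun j => hθ₁s _
  choose b hb using hb
  -- `β : B₁ → Λ₁` lifting `B₁ → C₀ → Λ₀`
  let βθ : B₁ →ₐ[R₁] Λ₀ :=
    { toRingHom := β₀.toRingHom.comp θ₁
      commutes' := fun r => by
        change β₀ (θ₁ (algebraMap R₁ B₁ r)) = algebraMap R₁ Λ₀ r
        rw [hθ₁r, β₀.commutes, ← IsScalarTower.algebraMap_apply] }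
  have hβθ : ∀ x, βθ x = β₀ (θ₁ x) := fun x => rfl
  have hkerp_nil : IsNilpotent (RingHom.ker (p : Λ₁ →+* Λ₀)) := by
    have : RingHom.ker (p : Λ₁ →+* Λ₀) = K.map (algebraMap R₁ Λ₁) := hkerp
    rw [this]
    exact Ideal.isNilpotent_map_of_isNilpotent _ hK
  haveI : Algebra.FormallySmooth R₁ B₁ := inferInstance
  let β : B₁ →ₐ[R₁] Λ₁ := Algebra.FormallySmooth.liftOfSurjective βθ p hp hkerp_nil
  have hβ : ∀ x, p (β x) = β₀ (θ₁ x) := fun x => by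
    rw [← hβθ, ← AlgHom.comp_apply, Algebra.FormallySmooth.comp_liftOfSurjective]
  -- the discrepancy `φ(z_j) - β(b_j)` lies in `KΛ₁`: write it as `Σ μ_i ε_i`
  have hdisc : ∀ j, φ (pr (X j)) - β (b j) ∈ K.map (algebraMap R₁ Λ₁) := fun j => by
    have : φ (pr (X j)) - β (b j) ∈ RingHom.ker p := by
      rw [RingHom.mem_ker, map_sub, hβ, hb, hαβ₀', hφ₀, sub_self]
    rwa [hkerp] at this
  have hrep : ∀ j, ∃ (n : ℕ) (μ : Fin n → Λ₁) (ε : Fin n → R₁), (∀ i, ε i ∈ K) ∧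
      φ (pr (X j)) - β (b j) = ∑ i, μ i * algebraMap R₁ Λ₁ (ε i) := by
    intro j
    obtain ⟨n, μ, g, hsum⟩ := Submodule.mem_span_set'.mp (hdisc j)
    have hg : ∀ i, ∃ ε ∈ K, algebraMap R₁ Λ₁ ε = (g i : Λ₁) := fun i => (g i).2
    choose ε hεK hεg using hg
    refine ⟨n, μ, ε, hεK, ?_⟩
    rw [← hsum]
    exact Finset.sum_congr rfl fun i _ => by rw [smul_eq_mul, hεg]
  choose nn μ ε hεK hrepr using hrep
  -- `B = B₁[δ]`, one variable `δ_{ji}` for each term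
  let D := Σ j : Fin m, Fin (nn j)
  let B := MvPolynomial D B₁
  haveI hB : Algebra.IsStandardSmooth R₁ B :=
    isStandardSmooth_mvPolynomial_of_isStandardSmooth R₁ B₁ D
  -- `χ' : P → B` and `β' : B → Λ₁` with `β' ∘ χ' = φ ∘ pr`
  let c : Fin m → B := fun j =>
    C (b j) + ∑ i : Fin (nn j), C (algebraMap R₁ B₁ (ε j i)) * X (⟨j, i⟩ : D)
  let χ' : MvPolynomial (Fin m) R₁ →ₐ[R₁] B := MvPolynomial.aeval c
  have hχ'X : ∀ j, χ' (X j) = c j := fun j => MvPolynomial.aeval_X _ _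
  let β' : B →ₐ[R₁] Λ₁ := MvPolynomial.aevalTower β fun d => μ d.1 d.2
  have hβ'C : ∀ x, β' (C x) = β x := fun x => MvPolynomial.aevalTower_C _ _ _
  have hβ'X : ∀ d : D, β' (X d) = μ d.1 d.2 := fun d => MvPolynomial.aevalTower_X _ _ _
  have hβ'χ' : β'.comp χ' = φ.comp pr := by
    apply MvPolynomial.algHom_ext
    intro j
    rw [AlgHom.comp_apply, AlgHom.comp_apply, hχ'X]
    simp only [c, map_add, map_sum, map_mul, hβ'C, hβ'X, AlgHom.commutes]
    rw [eq_comm, ← sub_eq_iff_eq_add', hrepr j]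
    exact Finset.sum_congr rfl fun i _ => mul_comm _ _
  have hβ'χ'' : ∀ q, β' (χ' q) = φ (pr q) := fun q => AlgHom.congr_fun hβ'χ' q
  -- `J = χ'(𝔞) B`
  set 𝔞 : Ideal (MvPolynomial (Fin m) R₁) := RingHom.ker pr.toRingHom with h𝔞
  have hmem𝔞 : ∀ a, a ∈ 𝔞 ↔ pr a = 0 := fun a => RingHom.mem_ker
  let J : Ideal B := 𝔞.map χ'
  have hJfg : J.FG := Ideal.FG.map hker_fg _
  -- `J ⊆ KB`: modulo `K`, `χ'` is `P → A → A₀ → C₀ ⊆ C₀[δ]`, which kills `𝔞`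
  have hΘχ : ∀ q : MvPolynomial (Fin m) R₁,
      MvPolynomial.map (σ := D) θ₁ (χ' q) = C (α₀ (u (pr q))) := by
    intro q
    suffices h : (MvPolynomial.map (σ := D) θ₁).comp χ'.toRingHom =
        (MvPolynomial.C.comp (α₀.toRingHom.comp u.toRingHom)).comp pr.toRingHom from
      RingHom.congr_fun h q
    apply MvPolynomial.ringHom_ext
    · intro r
      simp only [RingHom.coe_comp, Function.comp_apply, AlgHom.toRingHom_eq_coe,
        AlgHom.coe_toRingHom]
      rw [MvPolynomial.algHom_C, MvPolynomial.algHom_C, MvPolynomial.algebraMap_apply,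
        MvPolynomial.map_C, hθ₁r, hα₀r]
    · intro j
      simp only [RingHom.coe_comp, Function.comp_apply, AlgHom.toRingHom_eq_coe,
        AlgHom.coe_toRingHom, hχ'X, c, map_add, map_sum, map_mul, MvPolynomial.map_C,
        MvPolynomial.map_X, hb, hθ₁r, hKq _ (hεK _ _), map_zero, zero_mul,
        Finset.sum_const_zero, add_zero]
  have hΘker : RingHom.ker (MvPolynomial.map (σ := D) θ₁) = K.map (algebraMap R₁ B) := by
    rw [MvPolynomial.ker_map, hθ₁k, Ideal.map_map]
    rfl
  have hJK : J ≤ K.map (algebraMap R₁ B) := by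
    rw [Ideal.map_le_iff_le_comap]
    intro a ha
    rw [Ideal.mem_comap, ← hΘker, RingHom.mem_ker]
    change MvPolynomial.map (σ := D) θ₁ (χ' a) = 0
    rw [hΘχ, (hmem𝔞 a).mp ha, map_zero, map_zero, map_zero]
  -- `A = P/𝔞 → B/J` and `B/J → Λ₁`
  let e : (MvPolynomial (Fin m) R₁ ⧸ 𝔞) ≃ₐ[R₁] A := Ideal.quotientKerAlgEquivOfSurjective hpr
  have he : ∀ q, e.symm (pr q) = Ideal.Quotient.mk 𝔞 q := fun q => by
    rw [AlgEquiv.symm_apply_eq]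
    rfl
  let α₁ : (MvPolynomial (Fin m) R₁ ⧸ 𝔞) →ₐ[R₁] B ⧸ J := Ideal.quotientMapₐ J χ' Ideal.le_comap_map
  let α : A →ₐ[R₁] B ⧸ J := α₁.comp (e.symm : A →ₐ[R₁] MvPolynomial (Fin m) R₁ ⧸ 𝔞)
  have hJβ' : ∀ x ∈ J, β' x = 0 := by
    have hle : J ≤ RingHom.ker β'.toRingHom := by
      rw [Ideal.map_le_iff_le_comap]
      intro a ha
      rw [Ideal.mem_comap, RingHom.mem_ker]
      change β' (χ' a) = 0
      rw [hβ'χ'', (hmem𝔞 a).mp ha, map_zero]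
    intro x hx
    exact hle hx
  let βbar : B ⧸ J →ₐ[R₁] Λ₁ := Ideal.Quotient.liftₐ J β' hJβ'
  refine ⟨B, inferInstance, inferInstance, hB, J, hJfg, hJK, α, βbar, ?_⟩
  apply AlgHom.ext
  intro x
  obtain ⟨q, rfl⟩ := hpr x
  change βbar (α₁ (e.symm (pr q))) = φ (pr q)
  rw [he]
  change Ideal.Quotient.lift J (β' : B →+* Λ₁) hJβ'
    (Ideal.quotientMap J (χ' : MvPolynomial (Fin m) R₁ →+* B) Ideal.le_comap_map
      (Ideal.Quotient.mk 𝔞 q)) = _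
  rw [Ideal.quotientMap_mk, Ideal.Quotient.lift_mk]
  exact hβ'χ'' q

/-- **Stacks, Lemma 07CL**, one generator (two-ring form, `K = ker(R₁ → R₀)` with `K² = 0`):
"Let `φ : B → Λ` be an `R`-algebra map with `B` [standard] smooth over `R`. Let `J ⊂ IB` be a
finitely generated ideal such that `φ(J) = 0`. Then there exist `R`-algebra maps
`B →α B' →β Λ` such that `B'` is [standard] smooth over `R`, `α(J) = 0` and `β ∘ α = φ`" — case
`J = (h)`. Printed proof: write `h = Σ ε_i b_i`, `ε_i ∈ I`; flatness of `Λ` (equational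
criterion, Algebra 00HK) gives `φ(b_i) = Σ a_{ij} λ_j` with `Σ_i ε_i a_{ij} = 0`; set
`C = B[x_j]/(b_i - Σ a_{ij} x_j) → Λ`, factor `C → B'/J' → Λ` by Lemma 07CK, lift
`B → C → B'/J'` to `α : B → B'` by smoothness of `B`; then
`α(h) = Σ ε_i a_{ij} ξ_j + Σ ε_i θ_i = 0` as `θ_i ∈ J' ⊆ IB'` and `I² = 0`.
[cite: StacksProject, Tag 07CL] -/
theorem Stacks07CL_single (hq : Function.Surjective (algebraMap R₁ R₀))
    (hK2 : RingHom.ker (algebraMap R₁ R₀) * RingHom.ker (algebraMap R₁ R₀) = ⊥)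
    (p : Λ₁ →ₐ[R₁] Λ₀) (hp : Function.Surjective p)
    (hkerp : RingHom.ker p = (RingHom.ker (algebraMap R₁ R₀)).map (algebraMap R₁ Λ₁))
    [Module.Flat R₁ Λ₁] (h₀ : HasStandardSmoothFactorizations R₀ Λ₀)
    (B : Type u) [CommRing B] [Algebra R₁ B] [Algebra.IsStandardSmooth R₁ B]
    (φB : B →ₐ[R₁] Λ₁) (h : B) (hh : h ∈ (RingHom.ker (algebraMap R₁ R₀)).map (algebraMap R₁ B))
    (hφh : φB h = 0) :
    ∃ (B' : Type u) (_ : CommRing B') (_ : Algebra R₁ B'), Algebra.IsStandardSmooth R₁ B' ∧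
      ∃ (α : B →ₐ[R₁] B') (β : B' →ₐ[R₁] Λ₁), β.comp α = φB ∧ α h = 0 := by
  classical
  set K := RingHom.ker (algebraMap R₁ R₀) with hKdef
  have hK : IsNilpotent K := ⟨2, by rw [pow_two, hK2, Ideal.zero_eq_bot]⟩
  -- `h = Σ b_i ε_i`
  obtain ⟨n, bc, g, hsum⟩ := Submodule.mem_span_set'.mp hh
  have hg : ∀ i, ∃ ε ∈ K, algebraMap R₁ B ε = (g i : B) := fun i => (g i).2
  choose ε hεK hεg using hg
  have hsum' : h = ∑ i, bc i * algebraMap R₁ B (ε i) := by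
    rw [← hsum]
    exact Finset.sum_congr rfl fun i _ => by rw [smul_eq_mul, hεg]
  -- the relation `Σ ε_i φ(b_i) = 0` in the flat module `Λ₁` is trivial
  have hrel : ∑ i, ε i • φB (bc i) = 0 := by
    have : φB h = ∑ i, ε i • φB (bc i) := by
      rw [hsum', map_sum]
      exact Finset.sum_congr rfl fun i _ => by
        rw [map_mul, AlgHom.commutes, Algebra.smul_def, mul_comm]
    rw [← this, hφh]
  obtain ⟨k, a, y, hy, ha⟩ := Module.Flat.isTrivialRelation_of_sum_smul_eq_zero hrel
  -- `C = B[x_j]/(b_i - Σ a_{ij} x_j) → Λ₁`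
  let rel : Fin n → MvPolynomial (Fin k) B := fun i =>
    C (bc i) - ∑ j, C (algebraMap R₁ B (a i j)) * X j
  let 𝔠 : Ideal (MvPolynomial (Fin k) B) := Ideal.span (Set.range rel)
  have h𝔠fg : 𝔠.FG := ⟨(Finset.univ.image rel), by rw [Finset.coe_image, Finset.coe_univ,
    Set.image_univ]⟩
  haveI : Algebra.FinitePresentation R₁ B := inferInstance
  haveI : Algebra.FinitePresentation B (MvPolynomial (Fin k) B) := inferInstance
  haveI : Algebra.FinitePresentation R₁ (MvPolynomial (Fin k) B) :=
    Algebra.FinitePresentation.trans R₁ B (MvPolynomial (Fin k) B)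
  haveI : Algebra.FinitePresentation R₁ (MvPolynomial (Fin k) B ⧸ 𝔠) :=
    Algebra.FinitePresentation.quotient h𝔠fg
  let ψ₀ : MvPolynomial (Fin k) B →ₐ[R₁] Λ₁ := MvPolynomial.aevalTower φB y
  have hψ₀C : ∀ x, ψ₀ (C x) = φB x := fun x => MvPolynomial.aevalTower_C _ _ _
  have hψ₀X : ∀ j, ψ₀ (X j) = y j := fun j => MvPolynomial.aevalTower_X _ _ _
  have hψ₀rel : ∀ x ∈ 𝔠, ψ₀ x = 0 := by
    intro x hx
    rw [← RingHom.mem_ker]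
    refine (Ideal.span_le.mpr ?_) hx
    rintro _ ⟨i, rfl⟩
    rw [SetLike.mem_coe, RingHom.mem_ker]
    change ψ₀ (rel i) = 0
    simp only [rel, map_sub, map_sum, map_mul, hψ₀C, hψ₀X, AlgHom.commutes, hy i,
      Algebra.smul_def, sub_self]
  let ψ : (MvPolynomial (Fin k) B ⧸ 𝔠) →ₐ[R₁] Λ₁ := Ideal.Quotient.liftₐ 𝔠 ψ₀ hψ₀rel
  -- Lemma 07CK for `C → Λ₁`
  obtain ⟨B', _, _, hB', J', -, hJ'K, γ, δ, hγδ⟩ :=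
    Stacks07CK_exists_factorization hq hK p hp hkerp h₀ (MvPolynomial (Fin k) B ⧸ 𝔠) ψ
  have hγδ' : ∀ z, δ (γ z) = ψ z := fun z => AlgHom.congr_fun hγδ z
  -- `J'` is nilpotent (`J' ⊆ KB'`, `K² = 0`)
  have hKB'2 : K.map (algebraMap R₁ B') * K.map (algebraMap R₁ B') = ⊥ := by
    rw [← Ideal.map_mul, hK2, Ideal.map_bot]
  have hJ'nil : IsNilpotent J' := by
    refine ⟨2, ?_⟩
    rw [pow_two, Ideal.zero_eq_bot, eq_bot_iff, ← hKB'2]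
    exact Ideal.mul_mono hJ'K hJ'K
  -- lift `B → C → B'/J'` to `α : B → B'`
  let ιC : B →ₐ[R₁] MvPolynomial (Fin k) B ⧸ 𝔠 :=
    (Ideal.Quotient.mkₐ R₁ 𝔠).comp (IsScalarTower.toAlgHom R₁ B (MvPolynomial (Fin k) B))
  have hιC : ∀ x, ιC x = Ideal.Quotient.mk 𝔠 (C x) := fun x => rfl
  haveI : Algebra.FormallySmooth R₁ B := inferInstance
  let α : B →ₐ[R₁] B' := Algebra.FormallySmooth.lift J' hJ'nil (γ.comp ιC)
  have hα : ∀ x, Ideal.Quotient.mk J' (α x) = γ (ιC x) := fun x =>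
    Algebra.FormallySmooth.mk_lift _ _ _ x
  let β : B' →ₐ[R₁] Λ₁ := δ.comp (Ideal.Quotient.mkₐ R₁ J')
  have hβα : β.comp α = φB := by
    apply AlgHom.ext
    intro x
    change δ (Ideal.Quotient.mk J' (α x)) = φB x
    rw [hα, hγδ', hιC]
    change Ideal.Quotient.lift 𝔠 (ψ₀ : MvPolynomial (Fin k) B →+* Λ₁) hψ₀rel
      (Ideal.Quotient.mk 𝔠 (C x)) = φB x
    rw [Ideal.Quotient.lift_mk]
    exact hψ₀C x
  refine ⟨B', inferInstance, inferInstance, hB', α, β, hβα, ?_⟩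
  -- `α h = 0`
  have hξ : ∀ j, ∃ ξ : B', Ideal.Quotient.mk J' ξ = γ (Ideal.Quotient.mk 𝔠 (X j)) := fun j =>
    Ideal.Quotient.mk_surjective _
  choose ξ hξ using hξ
  -- `θ_i = α(b_i) - Σ a_{ij} ξ_j ∈ J'`
  have hθ : ∀ i, α (bc i) - ∑ j, algebraMap R₁ B' (a i j) * ξ j ∈ J' := by
    intro i
    rw [← Ideal.Quotient.eq_zero_iff_mem, map_sub, hα, map_sum, hιC]
    have hCi : (Ideal.Quotient.mk 𝔠 (C (bc i)) : MvPolynomial (Fin k) B ⧸ 𝔠) =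
        Ideal.Quotient.mk 𝔠 (∑ j, C (algebraMap R₁ B (a i j)) * X j) := by
      rw [Ideal.Quotient.eq]
      exact Ideal.subset_span ⟨i, rfl⟩
    rw [hCi, map_sum, map_sum]
    refine sub_eq_zero.mpr (Finset.sum_congr rfl fun j _ => ?_)
    rw [map_mul, map_mul, map_mul, hξ, ← MvPolynomial.algebraMap_eq]
    congr 1
    rw [← IsScalarTower.algebraMap_apply, Ideal.Quotient.mk_algebraMap, AlgHom.commutes,
      Ideal.Quotient.mk_algebraMap]
  -- `θ_i ε_i = 0`
  have hθε : ∀ i, (α (bc i) - ∑ j, algebraMap R₁ B' (a i j) * ξ j) * algebraMap R₁ B' (ε i) = 0 := by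
    intro i
    have hmem : (α (bc i) - ∑ j, algebraMap R₁ B' (a i j) * ξ j) * algebraMap R₁ B' (ε i) ∈
        K.map (algebraMap R₁ B') * K.map (algebraMap R₁ B') :=
      Ideal.mul_mem_mul (hJ'K (hθ i)) (Ideal.mem_map_of_mem _ (hεK i))
    rw [hKB'2, Ideal.mem_bot] at hmem
    exact hmem
  have key : ∀ i, α (bc i) * algebraMap R₁ B' (ε i) = ∑ j, algebraMap R₁ B' (ε i * a i j) * ξ j := by
    intro i
    calc α (bc i) * algebraMap R₁ B' (ε i)
        = (∑ j, algebraMap R₁ B' (a i j) * ξ j) * algebraMap R₁ B' (ε i) +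
            (α (bc i) - ∑ j, algebraMap R₁ B' (a i j) * ξ j) * algebraMap R₁ B' (ε i) := by ring
      _ = ∑ j, algebraMap R₁ B' (ε i * a i j) * ξ j := by
          rw [hθε i, add_zero, Finset.sum_mul]
          exact Finset.sum_congr rfl fun j _ => by rw [map_mul]; ring
  calc α h = ∑ i, α (bc i) * algebraMap R₁ B' (ε i) := by
        rw [hsum', map_sum]
        exact Finset.sum_congr rfl fun i _ => by rw [map_mul, AlgHom.commutes]
    _ = ∑ i, ∑ j, algebraMap R₁ B' (ε i * a i j) * ξ j := Finset.sum_congr rfl fun i _ => key i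
    _ = ∑ j, algebraMap R₁ B' (∑ i, ε i * a i j) * ξ j := by
        rw [Finset.sum_comm]
        exact Finset.sum_congr rfl fun j _ => by rw [map_sum, Finset.sum_mul]
    _ = 0 := Finset.sum_eq_zero fun j _ => by rw [ha j, map_zero, zero_mul]

/-- **Stacks, Lemma 07CL** (two-ring form, `K² = 0`): for `φ : B → Λ₁` with `B` standard
smooth over `R₁` and finitely many `h₁, …, h_n ∈ KB` killed by `φ`, there are `B →α B' →β Λ₁`
with `B'` standard smooth over `R₁`, `β ∘ α = φ` and `α(h_i) = 0`. Printed proof: induction on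
the number of generators from the case `n = 1` (`Stacks07CL_single`).
[cite: StacksProject, Tag 07CL] -/
theorem Stacks07CL_exists_factorization (hq : Function.Surjective (algebraMap R₁ R₀))
    (hK2 : RingHom.ker (algebraMap R₁ R₀) * RingHom.ker (algebraMap R₁ R₀) = ⊥)
    (p : Λ₁ →ₐ[R₁] Λ₀) (hp : Function.Surjective p)
    (hkerp : RingHom.ker p = (RingHom.ker (algebraMap R₁ R₀)).map (algebraMap R₁ Λ₁))
    [Module.Flat R₁ Λ₁] (h₀ : HasStandardSmoothFactorizations R₀ Λ₀) (n : ℕ) :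
    ∀ (B : Type u) [CommRing B] [Algebra R₁ B], Algebra.IsStandardSmooth R₁ B →
      ∀ (φB : B →ₐ[R₁] Λ₁) (h : Fin n → B),
        (∀ i, h i ∈ (RingHom.ker (algebraMap R₁ R₀)).map (algebraMap R₁ B)) →
        (∀ i, φB (h i) = 0) →
        ∃ (B' : Type u) (_ : CommRing B') (_ : Algebra R₁ B'), Algebra.IsStandardSmooth R₁ B' ∧
          ∃ (α : B →ₐ[R₁] B') (β : B' →ₐ[R₁] Λ₁), β.comp α = φB ∧ ∀ i, α (h i) = 0 := by
  induction n with
  | zero =>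
    intro B _ _ hB φB h _ _
    exact ⟨B, inferInstance, inferInstance, hB, AlgHom.id R₁ B, φB, AlgHom.comp_id _,
      fun i => i.elim0⟩
  | succ n ih =>
    intro B _ _ hB φB h hhK hφh
    haveI := hB
    -- kill the last generator
    obtain ⟨B₁, _, _, hB₁, α₁, β₁, hβα₁, hα₁h⟩ := Stacks07CL_single hq hK2 p hp hkerp h₀ B φB
      (h (Fin.last n)) (hhK _) (hφh _)
    -- then the images of the others
    have hh' : ∀ i : Fin n, α₁ (h (Fin.castSucc i)) ∈
        (RingHom.ker (algebraMap R₁ R₀)).map (algebraMap R₁ B₁) := fun i => by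
      have h1 : (RingHom.ker (algebraMap R₁ R₀)).map (algebraMap R₁ B) ≤
          ((RingHom.ker (algebraMap R₁ R₀)).map (algebraMap R₁ B₁)).comap (α₁ : B →+* B₁) := by
        rw [Ideal.map_le_iff_le_comap, Ideal.comap_comap]
        have : (α₁ : B →+* B₁).comp (algebraMap R₁ B) = algebraMap R₁ B₁ :=
          RingHom.ext fun r => α₁.commutes r
        rw [this]
        exact Ideal.le_comap_map
      exact h1 (hhK (Fin.castSucc i))
    have hφh' : ∀ i : Fin n, β₁ (α₁ (h (Fin.castSucc i))) = 0 := fun i => by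
      rw [← AlgHom.comp_apply, hβα₁, hφh]
    obtain ⟨B₂, _, _, hB₂, α₂, β₂, hβα₂, hα₂h⟩ := ih B₁ hB₁ β₁ (fun i => α₁ (h (Fin.castSucc i)))
      hh' hφh'
    refine ⟨B₂, inferInstance, inferInstance, hB₂, α₂.comp α₁, β₂, ?_, fun i => ?_⟩
    · rw [← AlgHom.comp_assoc, hβα₂, hβα₁]
    · refine Fin.lastCases ?_ (fun i => ?_) i
      · rw [AlgHom.comp_apply, hα₁h, map_zero]
      · rw [AlgHom.comp_apply]
        exact hα₂h i

/-- **Stacks, Proposition 07CM, square-zero case** (two-ring form). Let `R₁ → R₀` be a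
surjective ring map whose kernel `K` has `K² = 0`, `Λ₁` a flat `R₁`-algebra and
`p : Λ₁ → Λ₀` a surjection over it with kernel `KΛ₁` (`Λ₀ = Λ₁/KΛ₁` as an `R₀`-algebra). If
every finitely presented `R₀`-algebra map to `Λ₀` factors through a standard smooth
`R₀`-algebra, then every finitely presented `R₁`-algebra map to `Λ₁` factors through a
standard smooth `R₁`-algebra: by 07CK, `A → B/J → Λ₁`; by 07CL, `B → B' → Λ₁` killing `J`;
compose. [cite: StacksProject, Tag 07CM] -/
theorem hasStandardSmoothFactorizations_of_sq_zero (hq : Function.Surjective (algebraMap R₁ R₀))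
    (hK2 : RingHom.ker (algebraMap R₁ R₀) * RingHom.ker (algebraMap R₁ R₀) = ⊥)
    (p : Λ₁ →ₐ[R₁] Λ₀) (hp : Function.Surjective p)
    (hkerp : RingHom.ker p = (RingHom.ker (algebraMap R₁ R₀)).map (algebraMap R₁ Λ₁))
    [Module.Flat R₁ Λ₁] (h₀ : HasStandardSmoothFactorizations R₀ Λ₀) :
    HasStandardSmoothFactorizations R₁ Λ₁ := by
  classical
  intro A _ _ hA φ
  haveI := hA
  have hK : IsNilpotent (RingHom.ker (algebraMap R₁ R₀)) :=
    ⟨2, by rw [pow_two, hK2, Ideal.zero_eq_bot]⟩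
  obtain ⟨B, _, _, hB, J, hJfg, hJK, α, βbar, hαβ⟩ :=
    Stacks07CK_exists_factorization hq hK p hp hkerp h₀ A φ
  haveI := hB
  obtain ⟨n, h, hspan⟩ := Submodule.fg_iff_exists_fin_generating_family.mp hJfg
  have hhJ : ∀ i, h i ∈ J := fun i => hspan ▸ Submodule.subset_span ⟨i, rfl⟩
  let φB : B →ₐ[R₁] Λ₁ := βbar.comp (Ideal.Quotient.mkₐ R₁ J)
  have hφBh : ∀ i, φB (h i) = 0 := fun i => by
    change βbar (Ideal.Quotient.mk J (h i)) = 0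
    rw [Ideal.Quotient.eq_zero_iff_mem.mpr (hhJ i), map_zero]
  obtain ⟨B', _, _, hB', α', β', hβα', hα'h⟩ := Stacks07CL_exists_factorization hq hK2 p hp hkerp
    h₀ n B hB φB h (fun i => hJK (hhJ i)) hφBh
  -- `α'` kills `J`, hence factors through `B/J`
  have hJα' : ∀ x ∈ J, α' x = 0 := by
    have hle : J ≤ RingHom.ker α'.toRingHom := by
      rw [← hspan]   -- J = span (range h) as submodule
      refine Submodule.span_le.mpr ?_
      rintro _ ⟨i, rfl⟩
      exact hα'h i
    exact fun x hx => hle hx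
  let α'' : B ⧸ J →ₐ[R₁] B' := Ideal.Quotient.liftₐ J α' hJα'
  have hβ'α'' : β'.comp α'' = βbar := by
    refine Ideal.Quotient.algHom_ext R₁ ?_
    rw [AlgHom.comp_assoc]
    have : α''.comp (Ideal.Quotient.mkₐ R₁ J) = α' := Ideal.Quotient.liftₐ_comp J α' hJα'
    rw [this, hβα']
  refine ⟨B', inferInstance, inferInstance, hB', α''.comp α, β', ?_⟩
  rw [← AlgHom.comp_assoc, hβ'α'', hαβ]

end Stacks07CK

/-! ## Stacks 07CM: nilpotent thickenings -/

section Stacks07CM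

variable {R : Type u} [CommRing R] {Λ : Type v} [CommRing Λ] [Algebra R Λ]

/-- Flatness of `Λ/JΛ` over `R/J` for a flat `R`-algebra `Λ` (base change). [folklore] -/
theorem flat_quotient_map_of_flat [Module.Flat R Λ] (J : Ideal R) :
    Module.Flat (R ⧸ J) (Λ ⧸ J.map (algebraMap R Λ)) :=
  Module.Flat.of_linearEquiv (Algebra.TensorProduct.quotIdealMapEquivQuotTensor Λ J).toLinearEquiv

/-- The kernel of `R/J → R/J₀` (`J ≤ J₀`) is `J₀/J`. [folklore] -/
theorem ker_factor_eq_map (J J₀ : Ideal R) (h : J ≤ J₀) :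
    RingHom.ker (Ideal.Quotient.factor h) = J₀.map (Ideal.Quotient.mk J) := by
  ext x
  obtain ⟨r, rfl⟩ := Ideal.Quotient.mk_surjective x
  rw [RingHom.mem_ker, Ideal.Quotient.factor_mk, Ideal.Quotient.eq_zero_iff_mem,
    Ideal.mem_quotient_iff_mem_sup, sup_eq_left.mpr h]

/-- **Stacks, Proposition 07CM — the induction on the order of nilpotency.** For ideals
`I^{m+1} ⊆ J ⊆ I` of `R` and a flat `R`-algebra `Λ`: if `Λ/IΛ` has standard smooth
factorisations over `R/I`, so does `Λ/JΛ` over `R/J`. Step: with `J₀ = J + I^{m+1}` (so that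
`(J₀/J)² = 0` in `R/J`), the square-zero case `hasStandardSmoothFactorizations_of_sq_zero`
applies to `R/J → R/J₀`, `Λ/JΛ → Λ/J₀Λ`. [cite: StacksProject, Tag 07CM] -/
theorem hasStandardSmoothFactorizations_quotient_of_pow_le [Module.Flat R Λ] (I : Ideal R)
    (h₀ : HasStandardSmoothFactorizations (R ⧸ I) (Λ ⧸ I.map (algebraMap R Λ))) (m : ℕ) :
    ∀ J : Ideal R, I ^ (m + 1) ≤ J → J ≤ I →
      HasStandardSmoothFactorizations (R ⧸ J) (Λ ⧸ J.map (algebraMap R Λ)) := by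
  induction m with
  | zero =>
    intro J hIJ hJI
    rw [zero_add, pow_one] at hIJ
    obtain rfl : J = I := le_antisymm hJI hIJ
    exact h₀
  | succ m ih =>
    intro J hIJ hJI
    -- `J₀ = J + I^{m+1}`
    set J₀ : Ideal R := J ⊔ I ^ (m + 1) with hJ₀
    have hJJ₀ : J ≤ J₀ := le_sup_left
    have hIJ₀ : I ^ (m + 1) ≤ J₀ := le_sup_right
    have hJ₀I : J₀ ≤ I := sup_le hJI (Ideal.pow_le_self (Nat.succ_ne_zero m))
    have h₀' := ih J₀ hIJ₀ hJ₀I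
    have hJ₀sq : J₀ * J₀ ≤ J := by
      rw [hJ₀, Ideal.sup_mul, Ideal.mul_sup, Ideal.mul_sup]
      refine sup_le (sup_le Ideal.mul_le_right Ideal.mul_le_right)
        (sup_le Ideal.mul_le_left ?_)
      rw [← pow_add]
      exact (Ideal.pow_le_pow_right (by omega)).trans hIJ
    -- `R₁ = R/J → R₀ = R/J₀`
    letI : Algebra (R ⧸ J) (R ⧸ J₀) := (Ideal.Quotient.factor hJJ₀).toAlgebra
    have halg : algebraMap (R ⧸ J) (R ⧸ J₀) = Ideal.Quotient.factor hJJ₀ := rfl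
    have hq : Function.Surjective (algebraMap (R ⧸ J) (R ⧸ J₀)) := by
      rw [halg]
      intro x
      obtain ⟨r, rfl⟩ := Ideal.Quotient.mk_surjective x
      exact ⟨Ideal.Quotient.mk J r, Ideal.Quotient.factor_mk hJJ₀ r⟩
    have hK : RingHom.ker (algebraMap (R ⧸ J) (R ⧸ J₀)) = J₀.map (Ideal.Quotient.mk J) := by
      rw [halg, ker_factor_eq_map]
    have hK2 : RingHom.ker (algebraMap (R ⧸ J) (R ⧸ J₀)) *
        RingHom.ker (algebraMap (R ⧸ J) (R ⧸ J₀)) = ⊥ := by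
      rw [hK, ← Ideal.map_mul, eq_bot_iff, ← Ideal.map_quotient_self J]
      exact Ideal.map_mono hJ₀sq
    -- `Λ₁ = Λ/JΛ → Λ₀ = Λ/J₀Λ`
    set L₁ : Ideal Λ := J.map (algebraMap R Λ) with hL₁
    set L₀ : Ideal Λ := J₀.map (algebraMap R Λ) with hL₀
    have hL : L₁ ≤ L₀ := Ideal.map_mono hJJ₀
    haveI : Module.Flat (R ⧸ J) (Λ ⧸ L₁) := flat_quotient_map_of_flat J
    letI : Algebra (R ⧸ J) (Λ ⧸ L₀) :=
      Ideal.Quotient.algebraQuotientOfLEComap (hJJ₀.trans Ideal.le_comap_map)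
    have halg₀ : ∀ r, algebraMap (R ⧸ J) (Λ ⧸ L₀) (Ideal.Quotient.mk J r) =
        Ideal.Quotient.mk L₀ (algebraMap R Λ r) := fun r => rfl
    haveI : IsScalarTower (R ⧸ J) (R ⧸ J₀) (Λ ⧸ L₀) :=
      IsScalarTower.of_algebraMap_eq fun x => by
        obtain ⟨r, rfl⟩ := Ideal.Quotient.mk_surjective x
        rw [halg₀, halg, Ideal.Quotient.factor_mk, Ideal.Quotient.algebraMap_quotient_map_quotient]
    let p : (Λ ⧸ L₁) →ₐ[R ⧸ J] Λ ⧸ L₀ :=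
      { toRingHom := Ideal.Quotient.factor hL
        commutes' := fun x => by
          obtain ⟨r, rfl⟩ := Ideal.Quotient.mk_surjective x
          change Ideal.Quotient.factor hL (algebraMap (R ⧸ J) (Λ ⧸ L₁) (Ideal.Quotient.mk J r)) = _
          rw [Ideal.Quotient.algebraMap_quotient_map_quotient, Ideal.Quotient.factor_mk, halg₀] }
    have hp' : (p : (Λ ⧸ L₁) →+* Λ ⧸ L₀) = Ideal.Quotient.factor hL := rfl
    have hp : Function.Surjective p := by
      intro x
      obtain ⟨l, rfl⟩ := Ideal.Quotient.mk_surjective x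
      exact ⟨Ideal.Quotient.mk L₁ l, Ideal.Quotient.factor_mk hL l⟩
    have hkerp : RingHom.ker p = (RingHom.ker (algebraMap (R ⧸ J) (R ⧸ J₀))).map
        (algebraMap (R ⧸ J) (Λ ⧸ L₁)) := by
      have h1 : RingHom.ker p = RingHom.ker (p : (Λ ⧸ L₁) →+* Λ ⧸ L₀) := rfl
      rw [h1, hp', ker_factor_eq_map, hK, Ideal.map_map, Ideal.map_map]
      congr 1
    exact hasStandardSmoothFactorizations_of_sq_zero hq hK2 p hp hkerp h₀'

/-- **Stacks, Proposition 07CM** (factorisation form): "Let `R → Λ` be a ring map. Let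
`I ⊂ R` be an ideal. Assume that (1) `I` is nilpotent, (2) `Λ/IΛ` is a filtered colimit of
smooth `R/I`-algebras, and (3) `R → Λ` is flat. Then `Λ` is a filtered colimit of smooth
`R`-algebras." Here (2) and the conclusion are in the factorisation form of Algebra 07C3 through
STANDARD smooth algebras (equivalent by Lemma 07CI; the standard smooth form is what the
induction needs). Printed proof: induction on the order of nilpotency reduces to `I² = 0`
(`hasStandardSmoothFactorizations_quotient_of_pow_le`, ending with `R → R/0`), which is Lemma
07CK plus Lemma 07CL (`hasStandardSmoothFactorizations_of_sq_zero`).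
[cite: StacksProject, Tag 07CM] -/
theorem Stacks07CM_hasStandardSmoothFactorizations [Module.Flat R Λ] (I : Ideal R)
    (hI : IsNilpotent I)
    (h₀ : HasStandardSmoothFactorizations (R ⧸ I) (Λ ⧸ I.map (algebraMap R Λ))) :
    HasStandardSmoothFactorizations R Λ := by
  obtain ⟨n, hn⟩ := hI
  -- down to `J = 0`
  have hbot : HasStandardSmoothFactorizations (R ⧸ (⊥ : Ideal R))
      (Λ ⧸ (⊥ : Ideal R).map (algebraMap R Λ)) := by
    refine hasStandardSmoothFactorizations_quotient_of_pow_le I h₀ n ⊥ ?_ bot_le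
    calc I ^ (n + 1) ≤ I ^ n := Ideal.pow_le_pow_right (Nat.le_succ n)
      _ = ⊥ := by rw [hn, Ideal.zero_eq_bot]
  -- and from `R/0` to `R`
  have hq : Function.Surjective (algebraMap R (R ⧸ (⊥ : Ideal R))) := Ideal.Quotient.mk_surjective
  have hK : RingHom.ker (algebraMap R (R ⧸ (⊥ : Ideal R))) = ⊥ := Ideal.mk_ker
  have hK2 : RingHom.ker (algebraMap R (R ⧸ (⊥ : Ideal R))) *
      RingHom.ker (algebraMap R (R ⧸ (⊥ : Ideal R))) = ⊥ := by
    rw [hK, Ideal.mul_bot]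
  let p : Λ →ₐ[R] Λ ⧸ (⊥ : Ideal R).map (algebraMap R Λ) := Ideal.Quotient.mkₐ R _
  have hp : Function.Surjective p := Ideal.Quotient.mk_surjective
  have hkerp : RingHom.ker p =
      (RingHom.ker (algebraMap R (R ⧸ (⊥ : Ideal R)))).map (algebraMap R Λ) := by
    rw [hK]
    exact Ideal.mk_ker
  exact hasStandardSmoothFactorizations_of_sq_zero hq hK2 p hp hkerp hbot

/-- **Stacks, Proposition 07CM**, with smooth (not necessarily standard smooth) factorisations
in the conclusion, i.e. "`Λ` is a filtered colimit of smooth `R`-algebras" in the form of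
Algebra, Lemma 07C3 (2) restricted to finitely presented sources. [cite: StacksProject, Tag 07CM] -/
theorem Stacks07CM_exists_smooth_factorization [Module.Flat R Λ] (I : Ideal R) (hI : IsNilpotent I)
    (h₀ : HasStandardSmoothFactorizations (R ⧸ I) (Λ ⧸ I.map (algebraMap R Λ)))
    (A : Type u) [CommRing A] [Algebra R A] [Algebra.FinitePresentation R A] (φ : A →ₐ[R] Λ) :
    ∃ (C : Type u) (_ : CommRing C) (_ : Algebra R C), Algebra.Smooth R C ∧
      ∃ (α : A →ₐ[R] C) (β : C →ₐ[R] Λ), β.comp α = φ := by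
  obtain ⟨C, _, _, hC, α, β, h⟩ :=
    Stacks07CM_hasStandardSmoothFactorizations I hI h₀ A inferInstance φ
  haveI := hC
  exact ⟨C, inferInstance, inferInstance, inferInstance, α, β, h⟩

end Stacks07CM


end Literature.AlgebraicGeometry.Resolution

end
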